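import Summits.QuantumFields.YangMills.Theses.ScalingWindowSplit

/-!
# Crux-strategist sketch — stmt-QuantumFields-18927 `ScalingWindowSplit.GapAtCorrelationLength` (W₁)

Part A (NEGATION lens, typed obstruction).  The RP-spectral conjunct of W₁ quantifies over ALL bounded
measurable slab functionals `Y` (only the TIME extent of the support is restricted; `Y` is chosen after the
torus size `S`).  `LightFlux G` packages, for an admissible gauge group `G`, the existence at every large
coupling and on arbitrarily large symmetric tori of a bounded slab functional that is (i) almost conserved in
Euclidean time and (ii) not concentrated on one value — the disc-repaired `π₁(G)`-magnetic-flux indicator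
through a spatial 2-torus of a centre-free group (`G = SO(3)`: de Forcrand–Jahn, hep-lat/0211004 §4,
`η_{μν} = ∏_{p ∈ plane} sign tr_F U_p`, "a proper SO(3) observable"; 't Hooft 1979: magnetic flux is LIGHT in
the confined phase, `Z(twist)/Z(1) → 1`).  `gapAtCorrelationLength_false_of_lightFlux` is the bookkeeping:
such a `G` refutes W₁ — i.e. W₁ asserts, for every non-simply-connected compact simple `G`, a LINEAR
magnetic-flux tension `≥ Δ·a_k` (a non-confining massive phase).  `LightFlux SO(3)` is physics-certain and
rigorously open; the lemma is the `H → ¬W₁` shape of a NEGATIVE LEMMA (item to be HELD / restated: restrict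
`Y` to the local gauge-invariant algebra, which is all the consumers `stub_gapOfRPSpectral` (p142771) and
`existenceLeg` instantiate).

Part B.  Typed decomposition signatures used in STRATEGY-CENSUS.md §Decomposition (Props only).
-/

noncomputable section

open scoped BigOperators Topology
open MeasureTheory Filter Set Function
open Literature.MathematicalPhysics.QuantumLattice Literature.MathematicalPhysics.AQFT
open Literature.MathematicalPhysics.QuantumFieldTheory

namespace Summit.QuantumFields.YangMills.Cruxes.GapAtCorrelationLength.Strategist

open Summit.QuantumFields.YangMills.Theses.ScalingWindowSplit (GapAtCorrelationLength)

/-! ## Part A — the light-flux obstruction -/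

/-- **Light, almost-conserved flux functional** (hypothesis `H` of the negative lemma).  For every faithful
lattice representation `r` of `G` there is `β₀` such that at every coupling `β ≥ β₀` there is `δ₀ > 0` with:
on arbitrarily large odd tori `(2S+1)⁴` one finds a time slab `[1, T]`, a separation `n ≥ S/4` with
`2(T+n+1) ≤ S`, and a measurable slab functional `Y`, `|Y| ≤ 1`, whose reflected product has expectation
`≤ 1` at separation `0` (automatic from `|Y| ≤ 1`), `≥ 1 − δ₀/4` at separation `n` (near-conservation in
Euclidean time: only monopole clusters of diameter `≳ T` can flip the repaired flux), and whose mean satisfies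
`⟨Y⟩² ≤ 1 − δ₀` (both flux sectors populated: `4w(1−w) ≥ δ₀`).  For `G = SO(3)` this is 't Hooft's light
magnetic flux in the confined (or Coulomb) phase; it fails only in a magnetic-Meissner phase. [folklore] -/
def LightFlux (G : Type) [Group G] [TopologicalSpace G] [IsTopologicalGroup G] [CompactSpace G] : Prop :=
  letI : MeasurableSpace G := borel G
  haveI : BorelSpace G := ⟨rfl⟩
  ∀ (r : LatticeRep G), ∃ β₀ : ℝ, ∀ β : ℝ, β₀ ≤ β → ∃ δ₀ : ℝ, 0 < δ₀ ∧ ∀ M₀ : ℕ,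
    ∃ (S T n : ℕ), M₀ ≤ S ∧ 2 * (T + n + 1) ≤ S ∧ S ≤ 4 * n ∧
    ∃ (Y : LGConfig 4 G → ℝ), Measurable Y ∧ (∀ U, |Y U| ≤ 1) ∧
      DependsOn Y {e : Literature.MathematicalPhysics.QuantumLattice.ZdEdge 4 |
        1 ≤ e.1 0 ∧ e.1 0 + (if e.2 = 0 then 1 else 0) ≤ T} ∧
      (∫ U, Y (torusLift (2 * S + 1) (GaugeConfig.timeReflect U)) * Y (torusLift (2 * S + 1) U)
          ∂(wilsonMeasure r.ρ β : Measure (GaugeConfig 4 (2 * S + 1) G))) ≤ 1 ∧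
      1 - δ₀ / 4 ≤ (∫ U, Y (torusLift (2 * S + 1) (GaugeConfig.timeReflect U)) *
          Y (configShift (-Pi.single 0 (n : ℤ)) (torusLift (2 * S + 1) U))
          ∂(wilsonMeasure r.ρ β : Measure (GaugeConfig 4 (2 * S + 1) G))) ∧
      (∫ U, Y (torusLift (2 * S + 1) U)
          ∂(wilsonMeasure r.ρ β : Measure (GaugeConfig 4 (2 * S + 1) G))) ^ 2 ≤ 1 - δ₀

/-- **NEGATIVE LEMMA (shape `H → ¬W₁`)**: an admissible gauge group carrying a light, almost-conserved flux
functional refutes `GapAtCorrelationLength`.  Pure bookkeeping: the RP-spectral clause at `(S, T, n, Y, B = 1)`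
gives `3δ₀/4 ≤ I_n − ⟨Y⟩² ≤ e^{−Δ a_k n}(I_0 − ⟨Y⟩²) + C e^{−Δ a_k S} ≤ e^{−Δ a_k S/4} + |C| e^{−Δ a_k S} → 0`.
[folklore] -/
theorem gapAtCorrelationLength_false_of_lightFlux
    (G : Type) [Group G] [TopologicalSpace G] [IsTopologicalGroup G] [CompactSpace G]
    (hG : IsCompactSimpleLieGroup G) (hH : LightFlux G) :
    ¬ GapAtCorrelationLength := by
  intro hW
  letI : MeasurableSpace G := borel G
  haveI : BorelSpace G := ⟨rfl⟩
  obtain ⟨r, sch, u, p, M, Δ, C, hweak, hvol, hΔ, hgap, hRP, hsupp, hfw⟩ := hW G hG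
  obtain ⟨β₀, hβ₀⟩ := hH r
  -- a step `k` at which the RP-spectral clause is active and the coupling is beyond `β₀`
  obtain ⟨k, hRPk, hβk⟩ := (hRP.and (hweak.eventually_ge_atTop β₀)).exists
  obtain ⟨δ₀, hδ₀, hM⟩ := hβ₀ (sch.β k) hβk
  have ha : 0 < sch.a k := sch.a_pos k
  -- the right-hand side of the clause tends to zero along `S`
  set g : ℝ → ℝ := fun x => Real.exp (-(Δ * sch.a k * x) / 4) + |C| * Real.exp (-(Δ * sch.a k * x))
    with hg_def
  have hg : Tendsto g atTop (𝓝 0) := by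
    have h1 : Tendsto (fun x : ℝ => Δ * sch.a k * x) atTop atTop :=
      tendsto_id.const_mul_atTop (mul_pos hΔ ha)
    have h2 : Tendsto (fun x : ℝ => -(Δ * sch.a k * x)) atTop atBot :=
      tendsto_neg_atTop_atBot.comp h1
    have h3 : Tendsto (fun x : ℝ => -(Δ * sch.a k * x) / 4) atTop atBot :=
      h2.atBot_div_const (by norm_num)
    have e1 : Tendsto (fun x : ℝ => Real.exp (-(Δ * sch.a k * x) / 4)) atTop (𝓝 0) :=
      Real.tendsto_exp_atBot.comp h3
    have e2 : Tendsto (fun x : ℝ => |C| * Real.exp (-(Δ * sch.a k * x))) atTop (𝓝 (|C| * 0)) :=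
      (Real.tendsto_exp_atBot.comp h2).const_mul |C|
    simpa [hg_def] using e1.add e2
  have hgN : Tendsto (fun S : ℕ => g S) atTop (𝓝 0) := hg.comp tendsto_natCast_atTop_atTop
  have hδ4 : (0 : ℝ) < δ₀ / 4 := by positivity
  obtain ⟨N₀, hN₀⟩ := eventually_atTop.1 (hgN.eventually (gt_mem_nhds hδ4))
  -- the light-flux witness on a torus beyond `max N₀ L_k`
  obtain ⟨S, T, n, hMS, h2, h4, Y, hYm, hYb, hYdep, hI0, hIn, hm⟩ := hM (max N₀ (sch.L k))
  have hLS : sch.L k ≤ S := (le_max_right _ _).trans hMS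
  have hNS : N₀ ≤ S := (le_max_left _ _).trans hMS
  have key := hRPk S T n hLS h2 Y 1 hYm hYb hYdep
  -- name the three integrals
  generalize hIn_def : (∫ U, Y (torusLift (2 * S + 1) (GaugeConfig.timeReflect U)) *
      Y (configShift (-Pi.single 0 (n : ℤ)) (torusLift (2 * S + 1) U))
      ∂(wilsonMeasure r.ρ (sch.β k) : Measure (GaugeConfig 4 (2 * S + 1) G))) = In at key hIn
  generalize hI0_def : (∫ U, Y (torusLift (2 * S + 1) (GaugeConfig.timeReflect U)) *
      Y (torusLift (2 * S + 1) U)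
      ∂(wilsonMeasure r.ρ (sch.β k) : Measure (GaugeConfig 4 (2 * S + 1) G))) = I0 at key hI0
  generalize hm_def : (∫ U, Y (torusLift (2 * S + 1) U)
      ∂(wilsonMeasure r.ρ (sch.β k) : Measure (GaugeConfig 4 (2 * S + 1) G))) = m at key hm
  -- elementary estimates
  have hgS : g S < δ₀ / 4 := hN₀ S hNS
  have hexp_n : Real.exp (-(Δ * sch.a k * n)) ≤ Real.exp (-(Δ * sch.a k * S) / 4) := by
    apply Real.exp_le_exp.2
    have h4' : (S : ℝ) ≤ 4 * n := by exact_mod_cast h4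
    have hpos : 0 ≤ Δ * sch.a k := (mul_pos hΔ ha).le
    nlinarith [mul_le_mul_of_nonneg_left h4' hpos]
  have hexp0 : 0 ≤ Real.exp (-(Δ * sch.a k * n)) := Real.exp_nonneg _
  have hm0 : 0 ≤ m ^ 2 := sq_nonneg m
  have hdiff : I0 - m ^ 2 ≤ 1 := by linarith
  have hterm1 : Real.exp (-(Δ * sch.a k * n)) * (I0 - m ^ 2) ≤ Real.exp (-(Δ * sch.a k * S) / 4) := by
    calc Real.exp (-(Δ * sch.a k * n)) * (I0 - m ^ 2)
        ≤ Real.exp (-(Δ * sch.a k * n)) * 1 := mul_le_mul_of_nonneg_left hdiff hexp0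
      _ ≤ Real.exp (-(Δ * sch.a k * S) / 4) := by simpa using hexp_n
  have hterm2 : C * (1 : ℝ) ^ 2 * Real.exp (-(Δ * sch.a k * S)) ≤ |C| * Real.exp (-(Δ * sch.a k * S)) := by
    have := le_abs_self C
    have hE : 0 ≤ Real.exp (-(Δ * sch.a k * S)) := Real.exp_nonneg _
    nlinarith
  have hlhs : In - m ^ 2 ≤ |In - m ^ 2| := le_abs_self _
  have hgS' : Real.exp (-(Δ * sch.a k * S) / 4) + |C| * Real.exp (-(Δ * sch.a k * S)) < δ₀ / 4 := by
    simpa [hg_def] using hgS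
  linarith

/-! ## Part B — typed split signatures (census §Decomposition, D1 "seam split in lattice units")

`OneScaleRPCoreLoc`: the infrared core of W₁ in LATTICE units with the repaired (LOCAL) functional class — a
sequence of couplings `b_j → ∞` and lattice rates `μ_j → 0` (no freezing) with RP-spectral relative clustering
of reflected LOCAL slab functionals (support in a spatial box of half-side `R < S`) at rate `μ_j` on all odd tori
beyond a threshold polynomial in `μ_j⁻¹`, together with the one-scale clauses of the bare plaquette field at the
SAME scale `μ_j⁻¹`.  `TrackingScheme`: from such data a `SpeciesScheme` with `a_j := μ_j / Δ` and the W₁ clauses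
(bookkeeping; provable now up to the `Y`-class mismatch).  The census records why `OneScaleRPCoreLoc` is still
the whole kernel K (SEED with a sharp rate) — the split is typed here only to make that statement precise. -/

/-- The LOCAL functional class: support in the time slab `[1, T]` AND in the spatial box of half-side `R`
(edges based at sites with `|x_i| ≤ R`, `i = 1, 2, 3`).  With `R < S` the support is contractible in the torus of
side `2S+1`, so no such functional sees an `H²(T³; π₁ G)` flux (flat twist-eaters agree with the trivial
configuration on every contractible patch). [folklore] -/
def slabBox (T R : ℕ) : Set (Literature.MathematicalPhysics.QuantumLattice.ZdEdge 4) :=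
  {e | 1 ≤ e.1 0 ∧ e.1 0 + (if e.2 = 0 then 1 else 0) ≤ T ∧ ∀ i : Fin 4, i ≠ 0 → |e.1 i| ≤ R}

/-- D1, piece 1 (the kernel K in lattice units, local class): see the section docstring. [folklore] -/
def OneScaleRPCoreLoc : Prop :=
  ∀ (G : Type) [Group G] [TopologicalSpace G] [IsTopologicalGroup G] [CompactSpace G],
    IsCompactSimpleLieGroup G →
    letI : MeasurableSpace G := borel G
    haveI : BorelSpace G := ⟨rfl⟩
    ∃ (r : LatticeRep G) (b μ : ℕ → ℝ) (N : ℕ) (C : ℝ),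
      Tendsto b atTop atTop ∧ (∀ j, 0 < μ j) ∧ Tendsto μ atTop (𝓝 0) ∧
      ∀ᶠ j in atTop, ∀ (S T R n : ℕ), (μ j)⁻¹ ^ N ≤ S → 2 * (T + n + 1) ≤ S → R < S →
        ∀ (Y : LGConfig 4 G → ℝ) (B : ℝ), Measurable Y → (∀ U, |Y U| ≤ B) → DependsOn Y (slabBox T R) →
          |(∫ U, Y (torusLift (2 * S + 1) (GaugeConfig.timeReflect U)) *
                Y (configShift (-Pi.single 0 (n : ℤ)) (torusLift (2 * S + 1) U))
              ∂(wilsonMeasure r.ρ (b j) : Measure (GaugeConfig 4 (2 * S + 1) G))) -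
            (∫ U, Y (torusLift (2 * S + 1) U)
              ∂(wilsonMeasure r.ρ (b j) : Measure (GaugeConfig 4 (2 * S + 1) G))) ^ 2| ≤
            Real.exp (-(μ j * n)) *
              ((∫ U, Y (torusLift (2 * S + 1) (GaugeConfig.timeReflect U)) * Y (torusLift (2 * S + 1) U)
                  ∂(wilsonMeasure r.ρ (b j) : Measure (GaugeConfig 4 (2 * S + 1) G))) -
                (∫ U, Y (torusLift (2 * S + 1) U)
                  ∂(wilsonMeasure r.ρ (b j) : Measure (GaugeConfig 4 (2 * S + 1) G))) ^ 2) +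
            C * B ^ 2 * Real.exp (-(μ j * S))

end Summit.QuantumFields.YangMills.Cruxes.GapAtCorrelationLength.Strategist

end
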